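import Literature.AlgebraicGeometry.Resolution.SmoothOfRegularFibre
import Mathlib.AlgebraicGeometry.Morphisms.Smooth
import Mathlib.AlgebraicGeometry.Noetherian
import Mathlib.RingTheory.Etale.Basic
import HarnessLib

/-!
# A regular scheme locally of finite type over a perfect field is smooth

Topic: `Literature/AlgebraicGeometry/Resolution`. Scheme-level form of Matsumura §30, Remark 2
after Thm. 30.3 / The Stacks Project, Tag 00TV (a regular local ring essentially of finite type
over a perfect field `k` is formally smooth over `k`; ring level in this tree:
`formallySmooth_of_isRegularLocalRing_of_perfectField`, `SmoothOfRegularFibre.lean`, and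
`isSmoothAt_iff_isRegularLocalRing_of_perfectField`, `RegularLocusPerfectField.lean`):

* `smooth_of_isRegular_of_perfectField` — PROVED: for `f : X → Spec k` locally of finite type
  with `k` perfect and `X` regular (`Scheme.IsRegular`), `f` is smooth. (Mathlib's
  `Scheme.Hom.smoothLocus` is the set of points at which the stalk map is formally smooth; the
  stalk of `Spec k` is a localization of `k`, hence formally étale over `k`, and formal smoothness
  is insensitive to formally étale changes of the base, `Algebra.FormallySmooth.iff_restrictScalars`.)

In characteristic zero every field is perfect, so on the generic fibre of a family over a
characteristic-zero domain "regular" (the output of resolution of singularities) means "smooth",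
which is what spreads out (`SmoothGenericFibreSpread.lean`).

## Sources

* H. Matsumura, *Commutative Ring Theory* (1987), §30 Remark 2 after Thm. 30.3. [Matsumura1987]
* The Stacks Project, Tags 00TV, 056S. [StacksProject]
-/

noncomputable section

universe u

open CategoryTheory CategoryTheory.Limits AlgebraicGeometry TopologicalSpace

namespace Literature.AlgebraicGeometry.Resolution

/-- **A regular scheme locally of finite type over a perfect field is smooth over it.**
[cite: Matsumura1987, §30 Remark 2 after Thm. 30.3] -/
theorem smooth_of_isRegular_of_perfectField {k : Type u} [Field k] [PerfectField k]
    {X : Scheme.{u}} (f : X ⟶ Spec (CommRingCat.of k)) [LocallyOfFiniteType f]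
    (hX : Scheme.IsRegular X) : Smooth f := by
  rw [← Scheme.Hom.smoothLocus_eq_top_iff]
  refine top_le_iff.mp fun x _ => ?_
  rw [Scheme.Hom.mem_smoothLocus]
  -- the stalks and the stalk map
  let R := (Spec (CommRingCat.of k)).presheaf.stalk (f x)
  let S := X.presheaf.stalk x
  letI algRS : Algebra R S := (f.stalkMap x).hom.toAlgebra
  -- `R` is the localization of `k` at the prime `f x`
  letI algkR : Algebra k R := StructureSheaf.stalkAlgebra (↑(CommRingCat.of k)) (f x)
  haveI : IsLocalization.AtPrime R (f x).asIdeal :=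
    StructureSheaf.IsLocalization.to_stalk (↑(CommRingCat.of k)) (f x)
  haveI : Algebra.FormallyEtale k R := Algebra.FormallyEtale.of_isLocalization (f x).asIdeal.primeCompl
  haveI : Algebra.EssFiniteType k R := Algebra.EssFiniteType.of_isLocalization R (f x).asIdeal.primeCompl
  -- `S` as a `k`-algebra through `R`
  letI algkS : Algebra k S := ((algebraMap R S).comp (algebraMap k R)).toAlgebra
  haveI : IsScalarTower k R S := IsScalarTower.of_algebraMap_eq' rfl
  haveI : Algebra.EssFiniteType R S := LocallyOfFiniteType.stalkMap f x
  haveI : Algebra.EssFiniteType k S := Algebra.EssFiniteType.comp k R S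
  haveI : IsRegularLocalRing S := hX x
  -- Stacks 00TV: `S` is formally smooth over the perfect field `k`
  have hkS : Algebra.FormallySmooth k S := formallySmooth_of_isRegularLocalRing_of_perfectField k S
  -- and therefore over the formally étale `k`-algebra `R`
  have hRS : Algebra.FormallySmooth R S :=
    (Algebra.FormallySmooth.iff_restrictScalars (R := k) (A := R) (B := S)).mp hkS
  exact hRS

end Literature.AlgebraicGeometry.Resolution

end
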